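import Literature.Geometry.Lorentzian.NearKerrLeafMinkowskiDodge
import Literature.Geometry.Lorentzian.NearKerrLeafMinkowskiBoosted
import HarnessLib

/-!
# A near-Kerr leaf in `J⁺(p)` that stays away from any bounded region (Minkowski space)

Conclusion of the sequence `NearKerrLeafMinkowski` (the time-stretched hyperboloid
`stretchLeaf a`, `a = √(1+ε)`, is an `(ε, k)`-near-Kerr leaf with `0` holes), `NearKerrLeafMinkowskiDodge`
(it outruns fast receding inertial observers) and `NearKerrLeafMinkowskiBoosted` (its Poincaré
transport `boostStretchLeaf a v q = q + Λ_v(stretchLeaf a)`: chart, constant deviation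
`−(a² − 1) dx⁰ ⊗ dx⁰`, `⊆ J⁺(q)`, `J⁻ = E4`, and the half-space property for `a‖v‖ ≥ 1`). Here:

* `isNearKerrLeaf_boostStretchLeaf`: for every `k`, `s > 0`, `‖v‖ < 1` and `q⁰ ≥ γ a` the transported
  set is an `(s, k)`-near-Kerr leaf of the Minkowski development with `0` holes (flat chart
  `q + Λ_v ∘ A_a ∘ ι` on `U₀ = ⊤`: smooth; an open embedding of the layer — translation ∘ Lorentz
  automorphism ∘ time stretch ∘ two open inclusions; layer image in `J⁺({x⁰ = 0})`; `Cᵏ` deviation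
  `≤ s`; upper layer in `I⁺(S)` — images of vertical segments are the timelike segments
  `c a Λ_v e₀ = c a (γ, γv)`; barrier clause vacuous since `J⁻(S) = E4`);
* `exists_isNearKerrLeaf_subset_causalFuture_forall_dist_lt` (packaged): for every `k`, `ε > 0`,
  every event `p`, every rest position `x̲_obs` and every `D` there is an `(ε, k)`-near-Kerr leaf
  `S ⊆ J⁺(p)` with `0` holes all of whose points are at spatial distance `> D` from `x̲_obs` — in
  particular the observer at rest `t ↦ (t, x̲_obs)` never crosses `S`, and neither does anything
  staying within distance `D` of it (`v = (2/(1+a)) e₁`, so `a‖v‖ ≥ 1`; `q = (T, x̲_obs + |D| e₁)`,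
  `T` late; the leaf lies in the half-space `{x¹ > x̲_obs¹ + |D|}`).

Consequence for the summit `FinalStateConjecture` (routes `BartnikGapSettling`, `QuietWindowCapture`):
a conclusion `∃ S', IsNearKerrLeaf k ε 0 … S' ∧ S' ⊆ J⁺(S)` cannot certify that the leaf comes near —
let alone "sees" — any bounded region of space: a small black hole, the focal tube of an incoming
pulse, the axis of a converging swarm. The honest unit core of the leaf is parked far out on the
light cone (the boost), and the far, superluminal part of the leaf recedes in front of a spatial
plane. So the sweeping property (Q) of the crux dossier
`Summits/FinalStateConjecture/FinalStateConjecture/Cruxes/BondiBartnikRigidity/ADDENDUM-a1.md` fails in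
the strongest sense; the blindness clause of the construction hypothesis `BlindCollapsedLeafExists`
(`…/Theorems/BondiBartnikRigidity/Negative/BondiBartnikRigidityFalseOfBlindCollapsedLeaf.lean`) is not
witnessed by the paper spacetimes W1–W3 of the crux dossiers (their far zones are Minkowski to
`O(μ/r)`, where this chart applies verbatim); and a repaired leaf predicate must add achronality of
`S'` (an entire `1`-Lipschitz graph in the chart is crossed by every complete inertial observer) or
a frame-adapted deviation, in addition to the hypothesis-side repairs already on record.

## References

* B. O'Neill, *Semi-Riemannian geometry*, Academic Press 1983, Ch. 9, pp. 233–236 (boosts) and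
  Ch. 14, p. 402 (causality of `ℝ⁴₁`). [ONeillSemiRiemannian1983]
* M. Dafermos, G. Holzegel, I. Rodnianski, M. Taylor, arXiv:2104.08222, §1 (chart/deviation
  vocabulary). [DafermosHolzegelRodnianskiTaylor2021]
-/

noncomputable section

open Set TopologicalSpace Filter Function
open scoped Manifold ContDiff Topology ENNReal

namespace Literature.Geometry.Lorentzian

namespace Minkowski

open Lorentz

/-! ### The boosted stretched leaf is a near-Kerr leaf -/

/-- On the layer `{−1 < t₀}` we have `x⁰ > ‖x̲‖ − 1` (since `√(1+r²) ≥ r`). [folklore] -/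
theorem norm_spatial_sub_one_lt_of_neg_one_lt_hypTime {x : E4}
    (hx : -1 < (hypBackground ⊤).time x) : ‖E4.spatial x‖ - 1 < x 0 := by
  rw [hypTime_eq] at hx
  have h1 : ‖E4.spatial x‖ ≤ √(1 + ‖E4.spatial x‖ ^ 2) :=
    (le_abs_self _).trans (abs_le_sqrt_one_add_sq _)
  linarith

/-- Time of the boosted stretched chart on the layer: `(q + Λ_v A_a x)⁰ ≥ q⁰ − γ a` for `−1 < t₀(x)`,
`1 ≤ a`, `‖v‖ < 1` (`γ(a x⁰ + ⟪v, x̲⟫) ≥ γ(a x⁰ − ‖x̲‖) > γ((a−1)‖x̲‖ − a) ≥ −γ a`). [folklore] -/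
theorem sub_le_boostStretchChart_apply_zero {a : ℝ} (ha : 1 ≤ a) {v : E3} (hv : ‖v‖ < 1) (q : E4)
    {x : (hypBackground ⊤).domain} (hx : -1 < (hypBackground ⊤).time x.1) :
    q 0 - gamma v * a ≤ boostStretchChart a v q x 0 := by
  rw [boostStretchChart_apply, PiLp.add_apply, boostCLM_apply_zero, timeStretch_apply_zero,
    spatial_timeStretch]
  have hγ : 0 < gamma v := gamma_pos hv
  have hx0 := norm_spatial_sub_one_lt_of_neg_one_lt_hypTime hx
  have hcs : -(‖v‖ * ‖E4.spatial x.1‖) ≤ inner ℝ v (E4.spatial x.1) :=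
    neg_le_of_abs_le (abs_real_inner_le_norm v (E4.spatial x.1))
  have hvn : ‖v‖ * ‖E4.spatial x.1‖ ≤ ‖E4.spatial x.1‖ :=
    mul_le_of_le_one_left (norm_nonneg _) hv.le
  have hkey : -a ≤ a * x.1 0 + inner ℝ v (E4.spatial x.1) := by
    nlinarith [norm_nonneg (E4.spatial x.1)]
  nlinarith

/-- **The boosted, translated stretched hyperboloid is an `(s, k)`-near-Kerr leaf of Minkowski space
with `0` holes**, for every `k`, every `s > 0` (`a = √(1+s)`), every lab velocity `‖v‖ < 1` and every
translation `q` with `q⁰ ≥ γ a` (so that the layer image has positive times): flat chart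
`Ψ₀ = q + Λ_v ∘ A_a ∘ ι` on `U₀ = ⊤` — smooth, an open embedding of the layer (translation ∘ Lorentz
automorphism ∘ time stretch ∘ two open inclusions), layer image in `J⁺({x⁰ = 0})`, `Cᵏ` deviation the
constant `s dx⁰ ⊗ dx⁰` in norm; upper layer in `I⁺(S)` (images of vertical segments are the timelike
segments `c a Λ_v e₀ = c a (γ, γ v)`); barrier clause from `J⁻(S) = E4` (explicit leaf point over
`ρ ê`, `⟪v, ê⟫ = ‖v‖`, `ρ` large). DHRT arXiv:2104.08222, §1; O'Neill 1983, Ch. 9 and Ch. 14.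
[cite: ONeillSemiRiemannian1983, Ch. 14, p. 402] -/
theorem isNearKerrLeaf_boostStretchLeaf (k : ℕ) {s : ℝ} (hs : 0 < s) {v : E3} (hv : ‖v‖ < 1)
    {q : E4} (hq : gamma v * √(1 + s) ≤ q 0) :
    vacuumCauchyDevelopment.toCauchyDevelopment.IsNearKerrLeaf k (ENNReal.ofReal s) 0 ![] ![]
      (boostStretchLeaf (√(1 + s)) v q) := by
  set a : ℝ := √(1 + s) with ha_def
  have ha1 : 1 < a := by
    rw [ha_def]
    exact (Real.lt_sqrt zero_le_one).2 (by nlinarith)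
  have ha0 : 0 < a := one_pos.trans ha1
  have hasq : a ^ 2 - 1 = s := by rw [ha_def, Real.sq_sqrt (by linarith)]; ring
  have hγ : 0 < gamma v := gamma_pos hv
  -- the layer `L₀ = {−1 < t₀ < 1}` of the flat chart is open
  set L₀ : Set (hypBackground ⊤).domain :=
    {x | -1 < (hypBackground ⊤).time x.1 ∧ (hypBackground ⊤).time x.1 < 1} with hL₀
  have hL₀open : IsOpen L₀ :=
    isOpen_Ioo.preimage (continuous_hypTime.comp continuous_subtype_val)
  refine ⟨![], ![], Fin.elim0, Fin.elim0, Fin.elim0, ⊤, hypBackground ⊤, fun i => i.elim0,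
    boostStretchChart a v q, fun i => i.elim0, fun i => i.elim0, L₀,
    {x | 0 < (hypBackground ⊤).time x.1 ∧ (hypBackground ⊤).time x.1 < 1},
    fun i => i.elim0, fun i => i.elim0, rfl, fun i => i.elim0, rfl, rfl, fun i => i.elim0,
    fun x _ => trivial, fun i => i.elim0, (contMDiff_boostStretchChart a v q).contMDiffOn, ?_, ?_,
    fun i => i.elim0, ?_, fun i => i.elim0, fun i => i.elim0, fun i => i.elim0, ?_, ?_, ?_⟩
  · -- open embedding of the layer: translation ∘ `Λ_v` ∘ `A_a` ∘ `ι_⊤` ∘ `ι_{L₀}`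
    have h := ((Homeomorph.addLeft q).isOpenEmbedding.comp
      ((boost v hv : E4 ≃L[ℝ] E4).toHomeomorph.isOpenEmbedding.comp
        (timeStretchEquiv a ha0.ne').toHomeomorph.isOpenEmbedding)).comp
      ((IsOpen.isOpenEmbedding_subtypeVal (⊤ : Opens E4).2).comp
        hL₀open.isOpenEmbedding_subtypeVal)
    exact h
  · -- the layer image lies in `J⁺({x⁰ = 0})`
    rintro _ ⟨x, hx, rfl⟩
    have h0 : 0 ≤ boostStretchChart a v q x 0 := by
      have := sub_le_boostStretchChart_apply_zero ha1.le hv q hx.1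
      linarith
    have h := ofTimeSpace_mem_causalFuture_range_embed h0 (E4.spatial (boostStretchChart a v q x))
    rwa [show E4.ofTimeSpace (boostStretchChart a v q x 0)
        (E4.spatial (boostStretchChart a v q x)) = boostStretchChart a v q x from
      E4.ofTimeSpace_time_spatial _] at h
  · -- `Cᵏ` deviation of the boosted stretched chart
    refine (deviationCk_boostStretchChart_le a hv q k 0).trans (le_of_eq ?_)
    rw [hasq, abs_of_pos hs]
  · -- the leaf is the slab image (no hole pieces)
    rw [iUnion_of_empty, union_empty]
    rfl
  · -- the upper layer lies in `I⁺(S)`: slide each point down to the slab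
    rw [iUnion_of_empty, union_empty]
    rintro _ ⟨x, hx, rfl⟩
    set c : ℝ := (hypBackground ⊤).time x.1 with hc
    set x' : (hypBackground ⊤).domain := ⟨x.1 - c • E4.basisVector 0, trivial⟩ with hx'
    have hx'0 : (hypBackground ⊤).time x'.1 = 0 := by
      rw [hx', hypTime_sub_smul_basisVector, hc, sub_self]
    have hmem : boostStretchChart a v q x' ∈ boostStretchLeaf a v q := ⟨x', hx'0, rfl⟩
    refine LorentzianMetric.chronologicalFuture_mono (g := vacuumCauchyDevelopment.metric)
      (singleton_subset_iff.2 hmem) (mem_chronologicalFuture_of_norm_lt ?_)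
    -- the difference is `c a Λ_v e₀ = c a (γ, γ v)`
    have hdiff : boostStretchChart a v q x - boostStretchChart a v q x' =
        (a * c) • boostCLM v (E4.basisVector 0) := by
      rw [boostStretchChart_apply, boostStretchChart_apply, add_sub_add_left_eq_sub, ← map_sub,
        ← map_sub, hx', sub_sub_cancel, timeStretch_smul_basisVector, map_smul]
    have he0 : (E4.basisVector 0 : E4) 0 = 1 := by simp
    have hsp : E4.spatial (boostStretchChart a v q x) - E4.spatial (boostStretchChart a v q x') =
        (a * c * gamma v) • v := by
      rw [← map_sub, hdiff, map_smul, spatial_boostCLM_apply, C0Extension.spatial_basisVector_zero,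
        inner_zero_right, zero_add, mul_zero, zero_add, smul_smul, he0, mul_one]
    have ht : boostStretchChart a v q x 0 - boostStretchChart a v q x' 0 = a * c * gamma v := by
      rw [← PiLp.sub_apply, hdiff, PiLp.smul_apply, boostCLM_apply_zero,
        C0Extension.spatial_basisVector_zero, inner_zero_right, add_zero, smul_eq_mul, he0, mul_one]
    have hc0 : 0 < c := hx.1
    have hca : 0 < a * c * gamma v := by positivity
    rw [hsp, ht, norm_smul, Real.norm_eq_abs, abs_of_pos hca]
    nlinarith
  · -- barrier clause: everything is in `J⁻(S)`
    exact fun z _ => mem_causalPast_boostStretchLeaf ha1 hv q z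

/-! ### Packaged -/

/-- **For every event `p`, every rest position `x̲_obs` and every distance `D` there is an
`(ε, k)`-near-Kerr leaf in `J⁺(p)`, with `0` holes, all of whose points are at spatial distance `> D`
from `x̲_obs`; in particular the observer at rest `t ↦ (t, x̲_obs)` never crosses it.** With
`s = min ε 1`, `a = √(1+s)`, boost velocity `v = (2/(1+a)) e₁` (so `1 ≤ a‖v‖`, `‖v‖ < 1`) and translation
`q = (T, x̲_obs + |D| e₁)`, `T = max (γ a) (p⁰ + ‖q̲ − p̲‖)`: the leaf `S = q + Λ_v(stretchLeaf a)` is an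
`(ε, k)`-leaf (`isNearKerrLeaf_boostStretchLeaf`), `S ⊆ J⁺(q) ⊆ J⁺(p)`, and `S` lies in the half-space
`{x¹ > x̲_obs¹ + |D|}` (`inner_spatial_sub_pos_of_mem_boostStretchLeaf`). So a conclusion
`∃ S', IsNearKerrLeaf k ε 0 … S' ∧ S' ⊆ J⁺(·)` never forces `S'` to come near a prescribed bounded
region of space: the sweeping property (Q) of the crux dossier ADDENDUM-a1 fails in the strongest
sense. O'Neill 1983, Ch. 9 and Ch. 14; DHRT arXiv:2104.08222, §1.
[cite: ONeillSemiRiemannian1983, Ch. 14, p. 402] -/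
theorem exists_isNearKerrLeaf_subset_causalFuture_forall_dist_lt (k : ℕ) {ε : ℝ≥0∞} (hε : 0 < ε)
    (p : E4) (x_obs : E3) (D : ℝ) :
    ∃ S : Set E4, vacuumCauchyDevelopment.toCauchyDevelopment.IsNearKerrLeaf k ε 0 ![] ![] S ∧
      S ⊆ vacuumCauchyDevelopment.metric.causalFuture vacuumCauchyDevelopment.timeOrientation
        ({p} : Set E4) ∧
      (∀ z ∈ S, D < ‖E4.spatial z - x_obs‖) ∧
      ∀ t : ℝ, E4.ofTimeSpace t x_obs ∉ S := by
  have hne : min ε 1 ≠ ⊤ := (min_le_right _ _).trans_lt ENNReal.one_lt_top |>.ne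
  set s : ℝ := (min ε 1).toReal with hs_def
  have h0 : 0 < s := ENNReal.toReal_pos (lt_min hε one_pos).ne' hne
  set a : ℝ := √(1 + s) with ha_def
  have ha : 1 < a := (Real.lt_sqrt zero_le_one).2 (by nlinarith)
  have ha0 : 0 < a := one_pos.trans ha
  -- velocity
  set e : E3 := EuclideanSpace.single (0 : Fin 3) (1 : ℝ) with he
  have hne1 : ‖e‖ = 1 := by simp [he]
  set c : ℝ := 2 / (1 + a) with hc
  have hc0 : 0 < c := by rw [hc]; positivity
  have hc1 : c < 1 := by rw [hc, div_lt_one (by linarith)]; linarith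
  have hac : 1 ≤ a * c := by
    rw [hc, ← mul_div_assoc, one_le_div (by linarith)]
    linarith
  set v : E3 := c • e with hv_def
  have hnv : ‖v‖ = c := by
    rw [hv_def, norm_smul, hne1, mul_one, Real.norm_eq_abs, abs_of_pos hc0]
  have hv : ‖v‖ < 1 := by rw [hnv]; exact hc1
  have hav : 1 ≤ a * ‖v‖ := by rw [hnv]; exact hac
  -- translation
  set xq : E3 := x_obs + |D| • e with hxq
  set T : ℝ := max (gamma v * a) (p 0 + ‖xq - E4.spatial p‖) with hT
  set q : E4 := E4.ofTimeSpace T xq with hq_def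
  have hq0 : q 0 = T := by rw [hq_def, E4.ofTimeSpace_apply_zero]
  have hqs : E4.spatial q = xq := by rw [hq_def, E4.spatial_ofTimeSpace]
  have hqT : gamma v * √(1 + s) ≤ q 0 := by rw [hq0, hT]; exact le_max_left _ _
  have hleaf := isNearKerrLeaf_boostStretchLeaf k h0 hv hqT
  -- the half-space property gives the distance bound
  have hdist : ∀ z ∈ boostStretchLeaf a v q, D < ‖E4.spatial z - x_obs‖ := by
    intro z hz
    have h := inner_spatial_sub_pos_of_mem_boostStretchLeaf hv hav hz
    rw [hqs, hxq, hv_def, real_inner_smul_left, ← sub_sub, inner_sub_right,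
      real_inner_smul_right, real_inner_self_eq_norm_sq, hne1, one_pow, mul_one] at h
    -- `h : 0 < c * (⟪e, z̲ − x̲_obs⟫ − |D|)`
    have h1 : 0 < inner ℝ e (E4.spatial z - x_obs) - |D| := (mul_pos_iff_of_pos_left hc0).1 h
    have h2 : inner ℝ e (E4.spatial z - x_obs) ≤ ‖E4.spatial z - x_obs‖ := by
      have := real_inner_le_norm e (E4.spatial z - x_obs)
      rwa [hne1, one_mul] at this
    have h3 : D ≤ |D| := le_abs_self D
    linarith
  refine ⟨boostStretchLeaf a v q, ?_, ?_, hdist, fun t ht => ?_⟩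
  · refine hleaf.mono le_rfl ?_
    rw [hs_def, ENNReal.ofReal_toReal hne]
    exact min_le_left _ _
  · -- `S ⊆ J⁺(q)` and `q ∈ J⁺(p)`, in coordinates
    intro z hz
    obtain ⟨y, rfl⟩ := exists_of_mem_boostStretchLeaf hz
    refine mem_causalFuture_vacuumCauchyDevelopment ?_
    have hcone : ‖E4.spatial (boostCLM v (E4.ofTimeSpace (a * √(1 + ‖y‖ ^ 2)) y))‖ ≤
        boostCLM v (E4.ofTimeSpace (a * √(1 + ‖y‖ ^ 2)) y) 0 := by
      refine norm_spatial_boostCLM_le hv ?_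
      rw [E4.spatial_ofTimeSpace, E4.ofTimeSpace_apply_zero]
      have h1 : ‖y‖ ≤ √(1 + ‖y‖ ^ 2) := (le_abs_self _).trans (abs_le_sqrt_one_add_sq ‖y‖)
      have h2 : 0 ≤ √(1 + ‖y‖ ^ 2) := Real.sqrt_nonneg _
      nlinarith
    have hpq : ‖xq - E4.spatial p‖ ≤ T - p 0 := by
      have := le_max_right (gamma v * a) (p 0 + ‖xq - E4.spatial p‖)
      rw [← hT] at this
      linarith
    rw [map_add, PiLp.add_apply, hqs, hq0]
    calc ‖xq + E4.spatial (boostCLM v (E4.ofTimeSpace (a * √(1 + ‖y‖ ^ 2)) y)) - E4.spatial p‖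
          = ‖(xq - E4.spatial p) +
              E4.spatial (boostCLM v (E4.ofTimeSpace (a * √(1 + ‖y‖ ^ 2)) y))‖ := by abel_nf
      _ ≤ ‖xq - E4.spatial p‖ +
            ‖E4.spatial (boostCLM v (E4.ofTimeSpace (a * √(1 + ‖y‖ ^ 2)) y))‖ := norm_add_le _ _
      _ ≤ (T - p 0) + boostCLM v (E4.ofTimeSpace (a * √(1 + ‖y‖ ^ 2)) y) 0 := add_le_add hpq hcone
      _ = T + boostCLM v (E4.ofTimeSpace (a * √(1 + ‖y‖ ^ 2)) y) 0 - p 0 := by ring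
  · -- the observer at rest never meets the leaf: its events have distance `0 ≤ |D|`... use `hdist`
    -- via the half-space sign directly
    have h := inner_spatial_sub_pos_of_mem_boostStretchLeaf hv hav ht
    rw [E4.spatial_ofTimeSpace, hqs, hxq, sub_add_cancel_left, inner_neg_right, hv_def,
      real_inner_smul_left, real_inner_smul_right, real_inner_self_eq_norm_sq, hne1] at h
    have : 0 ≤ c * (|D| * 1 ^ 2) := by positivity
    linarith

end Minkowski

end Literature.Geometry.Lorentzian

end
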